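import Summits.Ventures.Crystal3D.Theorems.StickyWulffConstantPolycrystalWulffBoundAggCertCheckSoundA

/-!
# `PolycrystalWulffBound`, line `PolyDensity`: soundness of the certificate checker, part B (corners, Jensen, the leaf theorem)

Route `StickyWulffConstant` of the venture `Summits/Ventures/Crystal3D`, crux `PolycrystalWulffBound`
(item `stmt-Ventures-19482`), second prover lane (poly-p2, gen 7).  The rational corner values are below the real
`Φ + KMAX·Γ` (`termsLB_le_termsUnit`, via `pow23lb_le`); a point of the box is a convex combination of the corners
(`trilinear_weights`) and `Φ + KMAX·Γ` is concave along it (affine forms commute with barycentres, Jensen for `x^{2/3}`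
on forms non-negative at the corners: `termsUnit_bary`); summing the rows with the weights and comparing with
`max(1,γ')·E` gives the LEAF THEOREM `checkLeaf_sound`: on the chamber part of a checked box the hundred rows imply
`κ ≤ E`.
WHAT THIS IS NOT: the tree induction (`…AggCertCheckTree`); F-C1 not moved.
-/

noncomputable section

namespace Summit.Ventures.Crystal3D.Theorems

open Finset
open Summit.Ventures.Crystal3D.Cruxes.PolycrystalWulffBound.PolyDensity (AggCert27_8)
/-! ### Corner values and barycentric (Jensen) step -/

/-- `Φ + KMAX·Γ` of one unit of a row. -/
def unitR (B : QBox) (l : AggLhs) (v : Bool) (x1 x2 x3 : ℝ) : ℝ :=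
  phiR B l v x1 x2 x3 + (KMAXQ : ℝ) * gamR B l x1 x2 x3

/-- `Σ y·(Φ + KMAX·Γ)` over the terms. -/
def termsUnit (B : QBox) : List Term → ℝ → ℝ → ℝ → ℝ
  | [], _, _, _ => 0
  | (r, v, y) :: ts, x1, x2, x3 => (y : ℝ) * unitR B (aggRow r).lhs v x1 x2 x3 + termsUnit B ts x1 x2 x3

/-- `termsUnit = termsPhi + KMAX·termsGam`. -/
theorem termsUnit_eq (B : QBox) (ts : List Term) (x1 x2 x3 : ℝ) :
    termsUnit B ts x1 x2 x3 = termsPhi B ts x1 x2 x3 + (KMAXQ : ℝ) * termsGam B ts x1 x2 x3 := by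
  induction ts with
  | nil => simp [termsUnit, termsPhi, termsGam]
  | cons t ts ih =>
    obtain ⟨r, v, y⟩ := t
    simp only [termsUnit, termsPhi, termsGam, unitR, ih]
    ring

/-- Unpacking `termsOK` for the head term. -/
theorem termsOK_cons {B : QBox} {r : ℕ} {v : Bool} {y : ℚ} {ts : List Term}
    (h : termsOK B ((r, v, y) :: ts) = true) :
    r < 100 ∧ 0 ≤ y ∧ (∀ g, lhsForm B (aggRow r).lhs v = some g → B.cornersNonneg g = true) ∧ termsOK B ts = true := by
  simp only [termsOK, Bool.and_eq_true, decide_eq_true_eq] at h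
  obtain ⟨⟨⟨hr, hy⟩, hg⟩, ht⟩ := h
  refine ⟨hr, hy, ?_, ht⟩
  intro g hfg
  rw [hfg] at hg
  exact hg

/-- `cornersNonneg g` gives non-negativity of the form at each corner (in `ℝ`). -/
theorem cornersNonneg_real {B : QBox} {g : Fin 15} (h : B.cornersNonneg g = true) (i : Fin 8) :
    0 ≤ aggL g (B.cx1 i) (B.cx2 i) (B.cx3 i) := by
  unfold QBox.cornersNonneg at h
  rw [List.all_eq_true] at h
  have hi := h i (List.mem_finRange i)
  rw [decide_eq_true_eq] at hi
  rw [← aggLQ_cast]; exact_mod_cast hi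

/-- The rational corner lower bound is below the real unit value at the corner. -/
theorem lhsLB_le_unitR (B : QBox) (l : AggLhs) (v : Bool)
    (hg : ∀ g, lhsForm B l v = some g → B.cornersNonneg g = true) (i : Fin 8) :
    ((lhsLB B l v i : ℚ) : ℝ) ≤ unitR B l v (B.cx1 i) (B.cx2 i) (B.cx3 i) := by
  have hpow : ∀ (g : Fin 15), B.cornersNonneg g = true →
      ((pow23lb (aggLQ g (B.cx1 i) (B.cx2 i) (B.cx3 i)) : ℚ) : ℝ) ≤
        aggL g (B.cx1 i) (B.cx2 i) (B.cx3 i) ^ ((2 : ℝ) / 3) := by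
    intro g hcg
    have hnn := cornersNonneg_real hcg i
    have h0 : 0 ≤ aggLQ g (B.cx1 i) (B.cx2 i) (B.cx3 i) := by
      have := hnn; rw [← aggLQ_cast] at this; exact_mod_cast this
    have := pow23lb_le h0
    rwa [aggLQ_cast] at this
  cases l with
  | pow k f =>
    cases hm : B.minor f with
    | some g =>
      have hcg := hg g (by simp [lhsForm, hm])
      simp only [lhsLB, unitR, phiR, gamR, hm, mul_zero, add_zero]
      push_cast
      exact mul_le_mul_of_nonneg_left (hpow g hcg) (by exact_mod_cast qK_nonneg k)
    | none => simp [lhsLB, unitR, phiR, gamR, hm]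
  | sum k =>
    cases v with
    | true =>
      cases hm : B.minor 3 with
      | some g =>
        have hcg := hg g (by simp [lhsForm, hm])
        simp only [lhsLB, unitR, phiR, gamR, hm, mul_zero, add_zero]
        push_cast
        exact mul_le_mul_of_nonneg_left (hpow g hcg) (by exact_mod_cast qK_nonneg k)
      | none => simp [lhsLB, unitR, phiR, gamR, hm]
    | false =>
      simp only [lhsLB, unitR, phiR, gamR, mul_zero, add_zero]
      push_cast; rw [aggLQ_cast]
  | recol => simp [lhsLB, unitR, phiR, gamR]
  | del f =>
    cases hm : B.minor f with
    | some g =>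
      have hcg := hg g (by simp [lhsForm, hm])
      simp only [lhsLB, unitR, phiR, gamR, hm, zero_add]
      push_cast
      exact mul_le_mul_of_nonneg_left (hpow g hcg) (by unfold KMAXQ; norm_num)
    | none => simp [lhsLB, unitR, phiR, gamR, hm]
  | zero => simp [lhsLB, unitR, phiR, gamR]

/-- Corner lower bounds below the term sum at the corner. -/
theorem termsLB_le_termsUnit (B : QBox) (ts : List Term) (h : termsOK B ts = true) (i : Fin 8) :
    ((termsLB B ts i : ℚ) : ℝ) ≤ termsUnit B ts (B.cx1 i) (B.cx2 i) (B.cx3 i) := by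
  induction ts with
  | nil => simp [termsLB, termsUnit]
  | cons t ts ih =>
    obtain ⟨r, v, y⟩ := t
    obtain ⟨-, hy, hg, hts⟩ := termsOK_cons h
    simp only [termsLB, termsUnit]
    push_cast
    have h1 := lhsLB_le_unitR B (aggRow r).lhs v hg i
    have h2 := ih hts
    have hy' : (0 : ℝ) ≤ y := by exact_mod_cast hy
    nlinarith [mul_le_mul_of_nonneg_left h1 hy']

/-- Corner coordinates in `ℝ` as `![…]` vectors (to match `trilinear_weights`). -/
theorem QBox.cx_cast (B : QBox) (i : Fin 8) :
    ((B.cx1 i : ℚ) : ℝ) = (![(B.a1 : ℝ), B.a1, B.a1, B.a1, B.b1, B.b1, B.b1, B.b1] : Fin 8 → ℝ) i ∧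
    ((B.cx2 i : ℚ) : ℝ) = (![(B.a2 : ℝ), B.a2, B.b2, B.b2, B.a2, B.a2, B.b2, B.b2] : Fin 8 → ℝ) i ∧
    ((B.cx3 i : ℚ) : ℝ) = (![(B.a3 : ℝ), B.b3, B.a3, B.b3, B.a3, B.b3, B.a3, B.b3] : Fin 8 → ℝ) i := by
  fin_cases i <;> simp [QBox.cx1, QBox.cx2, QBox.cx3]

/-- Barycentric data of a point of the box. -/
structure Bary (B : QBox) (x1 x2 x3 : ℝ) where
  w : Fin 8 → ℝ
  w_nonneg : ∀ i, 0 ≤ w i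
  w_sum : ∑ i, w i = 1
  m1 : ∑ i, w i * ((B.cx1 i : ℚ) : ℝ) = x1
  m2 : ∑ i, w i * ((B.cx2 i : ℚ) : ℝ) = x2
  m3 : ∑ i, w i * ((B.cx3 i : ℚ) : ℝ) = x3

/-- Every point of a non-degenerate box has barycentric data. -/
theorem QBox.bary (B : QBox) (h1 : B.a1 < B.b1) (h2 : B.a2 < B.b2) (h3 : B.a3 < B.b3) {x1 x2 x3 : ℝ}
    (l1 : (B.a1 : ℝ) ≤ x1) (u1 : x1 ≤ B.b1) (l2 : (B.a2 : ℝ) ≤ x2) (u2 : x2 ≤ B.b2) (l3 : (B.a3 : ℝ) ≤ x3)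
    (u3 : x3 ≤ B.b3) : Nonempty (Bary B x1 x2 x3) := by
  obtain ⟨w, hw, hw1, hs, ht, hr⟩ := trilinear_weights (s := x1) (t := x2) (r := x3)
    (by exact_mod_cast h1 : (B.a1 : ℝ) < B.b1) (by exact_mod_cast h2 : (B.a2 : ℝ) < B.b2)
    (by exact_mod_cast h3 : (B.a3 : ℝ) < B.b3) l1 u1 l2 u2 l3 u3
  refine ⟨⟨w, hw, hw1, ?_, ?_, ?_⟩⟩
  · rw [← hs]; exact Finset.sum_congr rfl fun i _ => by rw [(B.cx_cast i).1]
  · rw [← ht]; exact Finset.sum_congr rfl fun i _ => by rw [(B.cx_cast i).2.1]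
  · rw [← hr]; exact Finset.sum_congr rfl fun i _ => by rw [(B.cx_cast i).2.2]

/-- Affine forms commute with barycentres. -/
theorem aggL_bary {B : QBox} {x1 x2 x3 : ℝ} (b : Bary B x1 x2 x3) (g : Fin 15) :
    ∑ i, b.w i * aggL g (B.cx1 i) (B.cx2 i) (B.cx3 i) = aggL g x1 x2 x3 := by
  have key : ∀ i, b.w i * aggL g (B.cx1 i) (B.cx2 i) (B.cx3 i) =
      ((aggLcoef g).1 : ℝ) * b.w i + ((aggLcoef g).2.1 : ℝ) * (b.w i * ((B.cx1 i : ℚ) : ℝ)) +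
        ((aggLcoef g).2.2.1 : ℝ) * (b.w i * ((B.cx2 i : ℚ) : ℝ)) +
        ((aggLcoef g).2.2.2 : ℝ) * (b.w i * ((B.cx3 i : ℚ) : ℝ)) := fun i => by
    rw [aggL_eq_affine]; ring
  rw [Finset.sum_congr rfl (fun i _ => key i), Finset.sum_add_distrib, Finset.sum_add_distrib,
    Finset.sum_add_distrib, ← Finset.mul_sum, ← Finset.mul_sum, ← Finset.mul_sum, ← Finset.mul_sum, b.w_sum, b.m1,
    b.m2, b.m3, aggL_eq_affine]
  ring

/-- Jensen for one power atom: `Σ wᵢ g(cᵢ)^{2/3} ≤ g(x)^{2/3}` when `g ≥ 0` at the corners. -/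
theorem pow_atom_bary {B : QBox} {x1 x2 x3 : ℝ} (b : Bary B x1 x2 x3) (g : Fin 15)
    (hg : B.cornersNonneg g = true) :
    ∑ i, b.w i * aggL g (B.cx1 i) (B.cx2 i) (B.cx3 i) ^ ((2 : ℝ) / 3) ≤ aggL g x1 x2 x3 ^ ((2 : ℝ) / 3) := by
  have hconc := Real.concaveOn_rpow (p := (2 : ℝ) / 3) (by norm_num) (by norm_num)
  have hJ := hconc.le_map_sum (t := Finset.univ) (w := b.w) (p := fun i => aggL g (B.cx1 i) (B.cx2 i) (B.cx3 i))
    (fun i _ => b.w_nonneg i) b.w_sum (fun i _ => Set.mem_Ici.2 (cornersNonneg_real hg i))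
  simp only [smul_eq_mul] at hJ
  rw [aggL_bary b g] at hJ
  exact hJ

/-- Barycentric sub-linearity of one unit of a row. -/
theorem unitR_bary {B : QBox} {x1 x2 x3 : ℝ} (b : Bary B x1 x2 x3) (l : AggLhs) (v : Bool)
    (hg : ∀ g, lhsForm B l v = some g → B.cornersNonneg g = true) :
    ∑ i, b.w i * unitR B l v (B.cx1 i) (B.cx2 i) (B.cx3 i) ≤ unitR B l v x1 x2 x3 := by
  have hconst : ∀ c : ℝ, ∑ i, b.w i * c = c := fun c => by rw [← Finset.sum_mul, b.w_sum, one_mul]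
  have hatom : ∀ (g : Fin 15) (c : ℝ), 0 ≤ c → B.cornersNonneg g = true →
      ∑ i, b.w i * (c * aggL g (B.cx1 i) (B.cx2 i) (B.cx3 i) ^ ((2 : ℝ) / 3)) ≤ c * aggL g x1 x2 x3 ^ ((2 : ℝ) / 3) := by
    intro g c hc hcg
    have hJ := pow_atom_bary b g hcg
    calc ∑ i, b.w i * (c * aggL g (B.cx1 i) (B.cx2 i) (B.cx3 i) ^ ((2 : ℝ) / 3))
        = c * ∑ i, b.w i * aggL g (B.cx1 i) (B.cx2 i) (B.cx3 i) ^ ((2 : ℝ) / 3) := by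
          rw [Finset.mul_sum]; exact Finset.sum_congr rfl fun i _ => by ring
      _ ≤ c * aggL g x1 x2 x3 ^ ((2 : ℝ) / 3) := mul_le_mul_of_nonneg_left hJ hc
  cases l with
  | pow k f =>
    cases hm : B.minor f with
    | some g =>
      have hcg := hg g (by simp [lhsForm, hm])
      simp only [unitR, phiR, gamR, hm, mul_zero, add_zero]
      exact hatom g _ (by exact_mod_cast qK_nonneg k) hcg
    | none => simp [unitR, phiR, gamR, hm]
  | sum k =>
    cases v with
    | true =>
      cases hm : B.minor 3 with
      | some g =>
        have hcg := hg g (by simp [lhsForm, hm])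
        simp only [unitR, phiR, gamR, hm, mul_zero, add_zero]
        exact hatom g _ (by exact_mod_cast qK_nonneg k) hcg
      | none => simp [unitR, phiR, gamR, hm]
    | false =>
      simp only [unitR, phiR, gamR, mul_zero, add_zero]
      have hl := aggL_bary b 3
      calc ∑ i, b.w i * ((qK k : ℝ) * (B.cB : ℝ) * aggL 3 (B.cx1 i) (B.cx2 i) (B.cx3 i))
          = (qK k : ℝ) * (B.cB : ℝ) * ∑ i, b.w i * aggL 3 (B.cx1 i) (B.cx2 i) (B.cx3 i) := by
            rw [Finset.mul_sum]; exact Finset.sum_congr rfl fun i _ => by ring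
        _ = (qK k : ℝ) * (B.cB : ℝ) * aggL 3 x1 x2 x3 := by rw [hl]
      exact le_rfl
  | recol => simp [unitR, phiR, gamR, hconst]
  | del f =>
    cases hm : B.minor f with
    | some g =>
      have hcg := hg g (by simp [lhsForm, hm])
      simp only [unitR, phiR, gamR, hm, zero_add]
      exact hatom g _ (by exact_mod_cast KMAXQ_nonneg) hcg
    | none => simp [unitR, phiR, gamR, hm]
  | zero => simp [unitR, phiR, gamR]

/-- Barycentric sub-linearity of the term sum. -/
theorem termsUnit_bary {B : QBox} {x1 x2 x3 : ℝ} (b : Bary B x1 x2 x3) (ts : List Term)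
    (h : termsOK B ts = true) :
    ∑ i, b.w i * termsUnit B ts (B.cx1 i) (B.cx2 i) (B.cx3 i) ≤ termsUnit B ts x1 x2 x3 := by
  induction ts with
  | nil => simp [termsUnit]
  | cons t ts ih =>
    obtain ⟨r, v, y⟩ := t
    obtain ⟨-, hy, hg, hts⟩ := termsOK_cons h
    simp only [termsUnit]
    have h1 := unitR_bary b (aggRow r).lhs v hg
    have h2 := ih hts
    have hy' : (0 : ℝ) ≤ y := by exact_mod_cast hy
    have hsplit : ∑ i, b.w i * ((y : ℝ) * unitR B (aggRow r).lhs v (B.cx1 i) (B.cx2 i) (B.cx3 i) +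
        termsUnit B ts (B.cx1 i) (B.cx2 i) (B.cx3 i)) =
        (y : ℝ) * ∑ i, b.w i * unitR B (aggRow r).lhs v (B.cx1 i) (B.cx2 i) (B.cx3 i) +
          ∑ i, b.w i * termsUnit B ts (B.cx1 i) (B.cx2 i) (B.cx3 i) := by
      rw [Finset.mul_sum, ← Finset.sum_add_distrib]; exact Finset.sum_congr rfl fun i _ => by ring
    rw [hsplit]
    nlinarith [mul_le_mul_of_nonneg_left h1 hy']

/-! ### Summation lemmas and the leaf theorem -/

/-- `Σ y·lhs ≤ Σ y·rhs` when every row holds and the weights are non-negative. -/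
theorem termsLhs_le_rhs (B : QBox) (ts : List Term) (h : termsOK B ts = true)
    {x1 x2 x3 S κ E F1 F2 F3 FR Y1 Y2 Y3 YR A12 A13 A1R A23 A2R A3R ARR : ℝ}
    (hrows : ∀ r : ℕ, r < 100 → (aggRow r).lhs.val x1 x2 x3 S κ ≤
      (aggRow r).rhs E F1 F2 F3 FR Y1 Y2 Y3 YR A12 A13 A1R A23 A2R A3R ARR) :
    termsLhs ts x1 x2 x3 S κ ≤ termsRhsR ts E F1 F2 F3 FR Y1 Y2 Y3 YR A12 A13 A1R A23 A2R A3R ARR := by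
  induction ts with
  | nil => simp [termsLhs, termsRhsR]
  | cons t ts ih =>
    obtain ⟨r, v, y⟩ := t
    obtain ⟨hr, hy, -, hts⟩ := termsOK_cons h
    simp only [termsLhs, termsRhsR]
    have h1 := hrows r hr
    have hy' : (0 : ℝ) ≤ y := by exact_mod_cast hy
    nlinarith [mul_le_mul_of_nonneg_left h1 hy', ih hts]

/-- `Φ + κ·Γ ≤ Σ y·lhs` on the chamber part of the box. -/
theorem termsPhiGam_le_lhs (B : QBox) (ts : List Term) (h : termsOK B ts = true) {x1 x2 x3 S κ : ℝ}
    (h1 : 0 ≤ x1) (h2 : 0 ≤ x2) (h3 : 0 ≤ x3) (ht : x1 + x2 + x3 ≤ 1) (hx3 : x3 ≤ B.b3)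
    (hS : 0 ≤ S) (hκ : 0 ≤ κ)
    (hS1 : (1 - x1 - x2 - x3) ^ ((2 : ℝ) / 3) ≤ S)
    (hS2 : ∀ c : ℝ, 0 ≤ c → c ^ 3 * x3 ≤ 1 → (1 - x1 - x2 - x3) * c ≤ S) :
    termsPhi B ts x1 x2 x3 + κ * termsGam B ts x1 x2 x3 ≤ termsLhs ts x1 x2 x3 S κ := by
  induction ts with
  | nil => simp [termsPhi, termsGam, termsLhs]
  | cons t ts ih =>
    obtain ⟨r, v, y⟩ := t
    obtain ⟨-, hy, -, hts⟩ := termsOK_cons h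
    simp only [termsPhi, termsGam, termsLhs]
    have hone := lhs_ge_phi_gam B (aggRow r).lhs v h1 h2 h3 ht hx3 hS hκ hS1 hS2
    have hy' : (0 : ℝ) ≤ y := by exact_mod_cast hy
    nlinarith [mul_le_mul_of_nonneg_left hone hy', ih hts]

/-- `Φ ≥ 0` on the chamber. -/
theorem termsPhi_nonneg (B : QBox) (ts : List Term) (h : termsOK B ts = true) {x1 x2 x3 : ℝ}
    (h1 : 0 ≤ x1) (h2 : 0 ≤ x2) (h3 : 0 ≤ x3) (ht : x1 + x2 + x3 ≤ 1) : 0 ≤ termsPhi B ts x1 x2 x3 := by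
  induction ts with
  | nil => simp [termsPhi]
  | cons t ts ih =>
    obtain ⟨r, v, y⟩ := t
    obtain ⟨-, hy, -, hts⟩ := termsOK_cons h
    simp only [termsPhi]
    have hy' : (0 : ℝ) ≤ y := by exact_mod_cast hy
    have hone : 0 ≤ phiR B (aggRow r).lhs v x1 x2 x3 := by
      generalize (aggRow r).lhs = l
      cases l with
      | pow k f =>
        cases hm : B.minor f with
        | some g =>
          simp only [phiR, hm]
          exact mul_nonneg (by exact_mod_cast qK_nonneg k) (Real.rpow_nonneg (aggL_nonneg _ h1 h2 h3 ht) _)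
        | none => simp [phiR, hm]
      | sum k =>
        cases v with
        | true =>
          cases hm : B.minor 3 with
          | some g =>
            simp only [phiR, hm]
            exact mul_nonneg (by exact_mod_cast qK_nonneg k) (Real.rpow_nonneg (aggL_nonneg _ h1 h2 h3 ht) _)
          | none => simp [phiR, hm]
        | false =>
          simp only [phiR]
          exact mul_nonneg (mul_nonneg (by exact_mod_cast qK_nonneg k) (by exact_mod_cast B.cB_nonneg))
            (aggL_nonneg 3 h1 h2 h3 ht)
      | recol => simp [phiR]
      | del f => simp [phiR]
      | zero => simp [phiR]
    nlinarith [mul_nonneg hy' hone, ih hts]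

/-- The corner test implies `KMAX·max(1,γ') ≤ termsUnit` at every corner (in `ℝ`). -/
theorem corner_bound {B : QBox} {ts : List Term}
    (hall : (List.finRange 8).all (fun i => decide (KMAXQ * max 1 (gammaOf (termsRhs ts)) ≤ termsLB B ts i)) = true)
    (hOK : termsOK B ts = true) (i : Fin 8) :
    (KMAXQ : ℝ) * ((max 1 (gammaOf (termsRhs ts)) : ℚ) : ℝ) ≤ termsUnit B ts (B.cx1 i) (B.cx2 i) (B.cx3 i) := by
  rw [List.all_eq_true] at hall
  have hi := hall i (List.mem_finRange i)
  rw [decide_eq_true_eq] at hi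
  have hi' : ((KMAXQ * max 1 (gammaOf (termsRhs ts)) : ℚ) : ℝ) ≤ ((termsLB B ts i : ℚ) : ℝ) := by exact_mod_cast hi
  push_cast at hi'
  have := termsLB_le_termsUnit B ts hOK i
  push_cast at this ⊢
  linarith

/-- **Soundness of the leaf test**: on the chamber part of the box, the rows imply `κ ≤ E`. -/
theorem checkLeaf_sound (B : QBox) (ts : List Term) (hc : checkLeaf B ts = true)
    {x1 x2 x3 S κ E F1 F2 F3 FR Y1 Y2 Y3 YR A12 A13 A1R A23 A2R A3R ARR : ℝ}
    (l1 : (B.a1 : ℝ) ≤ x1) (u1 : x1 ≤ B.b1) (l2 : (B.a2 : ℝ) ≤ x2) (u2 : x2 ≤ B.b2) (l3 : (B.a3 : ℝ) ≤ x3)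
    (u3 : x3 ≤ B.b3) (h1 : 0 ≤ x1) (h2 : 0 ≤ x2) (h3 : 0 ≤ x3) (ht : x1 + x2 + x3 ≤ 1)
    (hE : 0 ≤ E) (hF1 : 0 ≤ F1) (hF2 : 0 ≤ F2) (hF3 : 0 ≤ F3) (hFR : 0 ≤ FR) (hY1 : 0 ≤ Y1) (hY2 : 0 ≤ Y2)
    (hY3 : 0 ≤ Y3) (hYR : 0 ≤ YR) (hA12 : 0 ≤ A12) (hA13 : 0 ≤ A13) (hA1R : 0 ≤ A1R) (hA23 : 0 ≤ A23)
    (hA2R : 0 ≤ A2R) (hA3R : 0 ≤ A3R) (hARR : 0 ≤ ARR) (hS : 0 ≤ S) (hκ0 : 0 ≤ κ) (hκ : κ ≤ (47623 : ℝ) / 5000)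
    (hS1 : (1 - x1 - x2 - x3) ^ ((2 : ℝ) / 3) ≤ S)
    (hS2 : ∀ c : ℝ, 0 ≤ c → c ^ 3 * x3 ≤ 1 → (1 - x1 - x2 - x3) * c ≤ S)
    (bF1 : F1 ≤ E) (bF2 : F2 ≤ E) (bF3 : F3 ≤ E) (bFR : FR ≤ E) (bY1 : Y1 ≤ 20000 / 34641 * E)
    (bY2 : Y2 ≤ 20000 / 34641 * E) (bY3 : Y3 ≤ 20000 / 34641 * E) (bYR : YR ≤ 20000 / 34641 * E) (bA12 : A12 ≤ E)
    (bA13 : A13 ≤ E) (bA1R : A1R ≤ E) (bA23 : A23 ≤ E) (bA2R : A2R ≤ E) (bA3R : A3R ≤ E) (bARR : ARR ≤ E)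
    (hrows : ∀ r : ℕ, r < 100 → (aggRow r).lhs.val x1 x2 x3 S κ ≤
      (aggRow r).rhs E F1 F2 F3 FR Y1 Y2 Y3 YR A12 A13 A1R A23 A2R A3R ARR) : κ ≤ E := by
  unfold checkLeaf at hc
  simp only [Bool.and_eq_true, decide_eq_true_eq] at hc
  obtain ⟨⟨⟨⟨⟨⟨⟨hb1, hb2⟩, hb3⟩, -⟩, -⟩, -⟩, hOK⟩, hall⟩ := hc
  obtain ⟨b⟩ := B.bary hb1 hb2 hb3 l1 u1 l2 u2 l3 u3
  set M : ℝ := ((max 1 (gammaOf (termsRhs ts)) : ℚ) : ℝ) with hM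
  have hM1 : 1 ≤ M := by rw [hM]; exact_mod_cast le_max_left _ _
  -- the unit sum at x dominates the corner bound
  have hU : (KMAXQ : ℝ) * M ≤ termsUnit B ts x1 x2 x3 := by
    have hb := termsUnit_bary b ts hOK
    have hc' : ∑ i, b.w i * termsUnit B ts (B.cx1 i) (B.cx2 i) (B.cx3 i) ≥ ∑ i, b.w i * ((KMAXQ : ℝ) * M) :=
      Finset.sum_le_sum fun i _ => mul_le_mul_of_nonneg_left (corner_bound hall hOK i) (b.w_nonneg i)
    rw [← Finset.sum_mul, b.w_sum, one_mul] at hc'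
    linarith
  rw [termsUnit_eq] at hU
  -- the rows
  have hR := termsLhs_le_rhs B ts hOK hrows
  rw [termsRhsR_eq] at hR
  have hG := rhs_le_gamma (termsRhs ts) hE hF1 hF2 hF3 hFR hY1 hY2 hY3 hYR hA12 hA13 hA1R hA23 hA2R hA3R hARR
    bF1 bF2 bF3 bFR bY1 bY2 bY3 bYR bA12 bA13 bA1R bA23 bA2R bA3R bARR
  have hL := termsPhiGam_le_lhs B ts hOK h1 h2 h3 ht u3 hS hκ0 hS1 hS2
  have hΦ := termsPhi_nonneg B ts hOK h1 h2 h3 ht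
  have hK : κ ≤ (KMAXQ : ℝ) := by unfold KMAXQ; push_cast; linarith
  -- algebra
  set Φ := termsPhi B ts x1 x2 x3
  set Γ := termsGam B ts x1 x2 x3
  have hME : Φ + κ * Γ ≤ M * E := by rw [hM]; linarith
  rcases le_or_gt M Γ with hcase | hcase
  · nlinarith [mul_nonneg hκ0 (sub_nonneg.2 hcase), mul_le_mul_of_nonneg_right hM1 hE]
  · nlinarith [mul_le_mul_of_nonneg_right hK (sub_nonneg.2 hcase.le), mul_le_mul_of_nonneg_right hM1 hE]

end Summit.Ventures.Crystal3D.Theorems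

end
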